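import Mathlib
import Summits.Ventures.DiscreteObjects.Mahler.TraceLiftMeasure
import Literature.NumberTheory.MahlerMeasure.MinimalMeasuresByDegree

/-!
# Kernel certificate of the degree-14 minimal measure (MRW Table 1, `D = 14`) (venture `DiscreteObjects`, target L)

Cell `pub-namedobj`, seat `pub-namedobj-mahler` (gen 10). Framing: lottery ticket; floor = certified
bounds/negative ranges.

PRINT CONTROL in the kernel via the generic Salem certificate `salem_traceLift_certificate`: the
Mossinghoff–Rhin–Wu Table-1 minimiser of degree 14 (`Literature.NumberTheory.MahlerMeasure.mrwPoly14`, printed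
measure `1.20002652`, `ν = 1` [cite: MossinghoffRhinWu2008, Table 1 p.453]) is the reciprocal lift of the
degree-7 trace polynomial `Q` below, whose 7 real roots are located by sign changes (6 of them in `(-2, 2)`,
one just below `-2`); hence it is a Salem polynomial and `M + M⁻¹ = |y₁|` gives
`1.20002652 < M(mrwPoly14) < 1.20002653`.
-/

namespace Summit.Ventures.DiscreteObjects.Mahler

open Polynomial Literature.NumberTheory.MahlerMeasure

/-- The trace polynomial of the degree-14 minimiser. -/
theorem traceLift_mrwTrace14 : traceLift (X ^ 7 - C 7 * X ^ 5 + X ^ 4 + C 13 * X ^ 3 - C 4 * X ^ 2 - C 4 * X + 1 : ℤ[X]) = mrwPoly14 := by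
  have hdeg : (X ^ 7 - C 7 * X ^ 5 + X ^ 4 + C 13 * X ^ 3 - C 4 * X ^ 2 - C 4 * X + 1 : ℤ[X]).natDegree = 7 := by compute_degree!
  rw [traceLift, hdeg, mrwPoly14]
  simp only [Finset.sum_range_succ, Finset.sum_range_zero, zero_add, coeff_add, coeff_sub, coeff_X_pow,
    coeff_C_mul, coeff_X, coeff_one]
  norm_num
  ring

/-- **`1.20002652 < M(mrwPoly14) < 1.20002653`** (MRW Table 1, `D = 14`: `1.20002652`, `ν = 1`). -/
theorem mrwPoly14_measure_enclosure :
    (120002652 / 10 ^ 8 : ℝ) < intMahlerMeasure mrwPoly14 ∧ intMahlerMeasure mrwPoly14 < 120002653 / 10 ^ 8 := by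
  set Q : ℤ[X] := X ^ 7 - C 7 * X ^ 5 + X ^ 4 + C 13 * X ^ 3 - C 4 * X ^ 2 - C 4 * X + 1 with hQdef
  have hQmonic : Q.Monic := by rw [hQdef]; monicity!
  have hQdeg : Q.natDegree = 7 := by rw [hQdef]; compute_degree!
  set f : ℝ → ℝ := fun y => y ^ 7 - 7 * y ^ 5 + y ^ 4 + 13 * y ^ 3 - 4 * y ^ 2 - 4 * y + 1 with hf
  have hcont : Continuous f := by rw [hf]; fun_prop
  have hfQ : ∀ y : ℝ, aeval (y : ℂ) Q = ((f y : ℝ) : ℂ) := by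
    intro y
    rw [hQdef, hf]
    simp only [map_add, map_sub, map_mul, map_pow, aeval_X, map_ofNat, map_one]
    push_cast; ring
  have root : ∀ a b : ℝ, a ≤ b → (f a < 0 ∧ 0 < f b) ∨ (f b < 0 ∧ 0 < f a) →
      ∃ y, a < y ∧ y < b ∧ f y = 0 := by
    intro a b hab h
    rcases h with ⟨ha, hb⟩ | ⟨hb, ha⟩
    · obtain ⟨y, hy, hfy⟩ := intermediate_value_Ioo hab hcont.continuousOn ⟨ha, hb⟩
      exact ⟨y, hy.1, hy.2, hfy⟩
    · obtain ⟨y, hy, hfy⟩ := intermediate_value_Ioo' hab hcont.continuousOn ⟨hb, ha⟩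
      exact ⟨y, hy.1, hy.2, hfy⟩
  set c₁ : ℝ := 120002652 / 10 ^ 8 with hc₁
  set c₂ : ℝ := 120002653 / 10 ^ 8 with hc₂
  obtain ⟨y1, h1a, h1b, h1f⟩ := root (-(c₂ + c₂⁻¹)) (-(c₁ + c₁⁻¹)) (by rw [hc₁, hc₂]; norm_num)
    (Or.inl ⟨by rw [hf, hc₂]; norm_num, by rw [hf, hc₁]; norm_num⟩)
  obtain ⟨y2, h2a, h2b, h2f⟩ := root ((-2) : ℝ) ((-1) : ℝ) (by norm_num)
    (Or.inr ⟨by rw [hf]; norm_num, by rw [hf]; norm_num⟩)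
  obtain ⟨y3, h3a, h3b, h3f⟩ := root ((-1) : ℝ) (0 : ℝ) (by norm_num)
    (Or.inl ⟨by rw [hf]; norm_num, by rw [hf]; norm_num⟩)
  obtain ⟨y4, h4a, h4b, h4f⟩ := root (0 : ℝ) ((1 : ℝ) / 2) (by norm_num)
    (Or.inr ⟨by rw [hf]; norm_num, by rw [hf]; norm_num⟩)
  obtain ⟨y5, h5a, h5b, h5f⟩ := root ((1 : ℝ) / 2) (1 : ℝ) (by norm_num)
    (Or.inl ⟨by rw [hf]; norm_num, by rw [hf]; norm_num⟩)
  obtain ⟨y6, h6a, h6b, h6f⟩ := root (1 : ℝ) ((3 : ℝ) / 2) (by norm_num)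
    (Or.inr ⟨by rw [hf]; norm_num, by rw [hf]; norm_num⟩)
  obtain ⟨y7, h7a, h7b, h7f⟩ := root ((3 : ℝ) / 2) (2 : ℝ) (by norm_num)
    (Or.inl ⟨by rw [hf]; norm_num, by rw [hf]; norm_num⟩)
  have hc1y : -(c₁ + c₁⁻¹) < -2 := by rw [hc₁]; norm_num
  have hy1 : y1 < -2 := lt_trans h1b hc1y
  set s : Multiset ℝ := {y1, y2, y3, y4, y5, y6, y7} with hs
  have h1_2 : y1 ≠ y2 := ne_of_lt (by linarith)
  have h1_3 : y1 ≠ y3 := ne_of_lt (by linarith)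
  have h1_4 : y1 ≠ y4 := ne_of_lt (by linarith)
  have h1_5 : y1 ≠ y5 := ne_of_lt (by linarith)
  have h1_6 : y1 ≠ y6 := ne_of_lt (by linarith)
  have h1_7 : y1 ≠ y7 := ne_of_lt (by linarith)
  have h2_3 : y2 ≠ y3 := ne_of_lt (by linarith)
  have h2_4 : y2 ≠ y4 := ne_of_lt (by linarith)
  have h2_5 : y2 ≠ y5 := ne_of_lt (by linarith)
  have h2_6 : y2 ≠ y6 := ne_of_lt (by linarith)
  have h2_7 : y2 ≠ y7 := ne_of_lt (by linarith)
  have h3_4 : y3 ≠ y4 := ne_of_lt (by linarith)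
  have h3_5 : y3 ≠ y5 := ne_of_lt (by linarith)
  have h3_6 : y3 ≠ y6 := ne_of_lt (by linarith)
  have h3_7 : y3 ≠ y7 := ne_of_lt (by linarith)
  have h4_5 : y4 ≠ y5 := ne_of_lt (by linarith)
  have h4_6 : y4 ≠ y6 := ne_of_lt (by linarith)
  have h4_7 : y4 ≠ y7 := ne_of_lt (by linarith)
  have h5_6 : y5 ≠ y6 := ne_of_lt (by linarith)
  have h5_7 : y5 ≠ y7 := ne_of_lt (by linarith)
  have h6_7 : y6 ≠ y7 := ne_of_lt (by linarith)
  have hnodup : s.Nodup := by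
    rw [hs]; simp [Multiset.insert_eq_cons, h1_2, h1_3, h1_4, h1_5, h1_6, h1_7, h2_3, h2_4, h2_5, h2_6, h2_7, h3_4, h3_5, h3_6, h3_7, h4_5, h4_6, h4_7, h5_6, h5_7, h6_7]
  have hcard : Multiset.card s = Q.natDegree := by rw [hQdeg, hs]; simp
  have hroot : ∀ y ∈ s, aeval (y : ℂ) Q = 0 := by
    intro y hy
    rw [hfQ]
    rw [hs] at hy
    simp only [Multiset.insert_eq_cons, Multiset.mem_cons, Multiset.mem_singleton] at hy
    rcases hy with rfl | rfl | rfl | rfl | rfl | rfl | rfl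
    · rw [h1f]; simp
    · rw [h2f]; simp
    · rw [h3f]; simp
    · rw [h4f]; simp
    · rw [h5f]; simp
    · rw [h6f]; simp
    · rw [h7f]; simp
  have hy₁ : y1 ∈ s := by rw [hs]; simp
  have hbig : 2 < |y1| := by rw [abs_of_neg (by linarith)]; linarith
  have hsmall : ∀ y ∈ s.erase y1, |y| ≤ 2 := by
    intro y hy
    have hy' : y ∈ s ∧ y ≠ y1 := ⟨Multiset.mem_of_mem_erase hy, ((Multiset.Nodup.mem_erase_iff hnodup).mp hy).1⟩
    rw [hs] at hy'
    simp only [Multiset.insert_eq_cons, Multiset.mem_cons, Multiset.mem_singleton] at hy'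
    obtain ⟨hy'', hne⟩ := hy'
    rcases hy'' with rfl | rfl | rfl | rfl | rfl | rfl | rfl
    · exact absurd rfl hne
    · rw [abs_le]; constructor <;> linarith
    · rw [abs_le]; constructor <;> linarith
    · rw [abs_le]; constructor <;> linarith
    · rw [abs_le]; constructor <;> linarith
    · rw [abs_le]; constructor <;> linarith
    · rw [abs_le]; constructor <;> linarith
  obtain ⟨-, hM1, hMM⟩ := salem_traceLift_certificate hQmonic s hnodup hcard hroot hy₁ hbig hsmall
  rw [traceLift_mrwTrace14] at hM1 hMM
  rw [abs_of_neg (by linarith)] at hMM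
  have hMpos : 0 < intMahlerMeasure mrwPoly14 := by linarith
  constructor
  · have h : c₁ + c₁⁻¹ < intMahlerMeasure mrwPoly14 + (intMahlerMeasure mrwPoly14)⁻¹ := by
      rw [hMM]; linarith
    exact lt_of_add_inv_lt_add_inv hM1.le (by rw [hc₁]; norm_num) h
  · have h : intMahlerMeasure mrwPoly14 + (intMahlerMeasure mrwPoly14)⁻¹ < c₂ + c₂⁻¹ := by
      rw [hMM]; linarith
    exact lt_of_add_inv_lt_add_inv (by rw [hc₂]; norm_num) hMpos h

end Summit.Ventures.DiscreteObjects.Mahler
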